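import Mathlib
import Summits.Ventures.HodgeRepro.PeriodCloserC7Stability
import Summits.Ventures.HodgeRepro.OcticCMPointS3

/-!
# OcticCMPointTameDual — the tame part of a conjugate-dual character at the three places of `S₃`: order `∣ 2` at the
ramified places `𝔭₁, 𝔭₂ | 5`, order `∣ 5` at the inert place `𝔮 | 2`

Blind re-derivation cell `pub-hodge-repro`, seat night-2 (gen 3).  Target tree path
`lean/Summits/Ventures/HodgeRepro/OcticCMPointTameDual.lean`.  Continues gen 1's `PeriodCloserC7Stability.lean`
(`LocalChar R`) and `OcticCMPointS3.lean` (`octic_p1 / octic_p2 / octic_q`).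

A conjugate-dual character `ω` of `K_v^×` (`ω ∘ σ = ω⁻¹`, `σ` the conjugation of `K_v/k_v` — both the conjugate-orthogonal
and the conjugate-symplectic characters of the route are such) has its unit part `ω.unit` on `𝒪/𝔭^c` satisfying
`ω.unit (σ x) = ω.unit⁻¹ x`.  On the residue field (`c = 1`, the TAME part):

* at a RAMIFIED place (`𝔭₁, 𝔭₂ | 5` of the octic point: residue degree `1`, `σ` acts trivially on `𝒪_K/𝔭 = 𝒪_k/𝔭 = 𝔽₅`)
  the unit part is its own inverse — `ω.unit * ω.unit = 1`: the tame part of a conjugate-dual character is QUADRATIC or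
  trivial (`unit_mul_self_eq_one_of_fixed`);
* at an INERT place (`𝔮 | 2`: `𝒪_K/𝔭 = 𝔽₁₆`, `σ = Frob_{q_k} : x ↦ x^{q_k}`, `q_k = 4`) the unit part satisfies
  `ω.unit x ^ (q_k + 1) = 1`: its order divides `q_k + 1 = 5 = q_K / q_k + 1` (`unit_pow_eq_one_of_frobenius`).

These are the tame shapes behind gen 1's `S3Place.tame_coprime` (the twist of `p`-power order lives on `1 + 𝔭`, never on
the tame quotient) and behind `OcticCMPointTameSign.lean` (where a character ramified at the tame level, `ω.unit ≠ 1`,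
is needed): at `𝔭₁, 𝔭₂` the only tame conjugate-dual characters ramified at level `1` are the quadratic one; at `𝔮` they
have order `5`.  Nothing is evaluated on the octic face's characters (on no page).  Nothing here says anything about the
status of the Hodge conjecture for CM abelian varieties, which is NOT proved.
-/

set_option autoImplicit false

noncomputable section

namespace Summit.Ventures.HodgeRepro.PeriodCloser

namespace LocalChar

variable {R : Type} [CommRing R]

/-- **Conjugate duality on the unit part**: `ω.unit ∘ σ = ω.unit⁻¹`. -/
def ConjDualUnit (ω : LocalChar R) (σ : R → R) : Prop := ∀ x : R, ω.unit (σ x) = ω.unit⁻¹ x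

/-- **The ramified tame shape**: if the conjugation acts trivially on `R` (residue degree `1`), a conjugate-dual unit
part is its own inverse: `ω.unit x * ω.unit x = 1` for every unit `x` — and `ω.unit * ω.unit = 1` as characters. -/
theorem unit_mul_self_eq_one_of_fixed (ω : LocalChar R) (σ : R → R) (hσ : ∀ x, σ x = x)
    (h : ConjDualUnit ω σ) : ω.unit * ω.unit = 1 := by
  ext x
  rw [MulChar.coeToFun_mul, Pi.mul_apply, MulChar.one_apply_coe]
  have hx := h x
  rw [hσ, MulChar.inv_apply_eq_inv'] at hx
  have hne : ω.unit (x : R) ≠ 0 := MulChar.apply_ne_zero_iff.mpr x.isUnit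
  calc ω.unit (x : R) * ω.unit (x : R) = ω.unit (x : R) * (ω.unit (x : R))⁻¹ := by rw [← hx]
    _ = 1 := mul_inv_cancel₀ hne

/-- **The inert tame shape**: if the conjugation is the Frobenius `x ↦ x ^ q` of the residue field of `k_v`, a
conjugate-dual unit part satisfies `ω.unit x ^ (q + 1) = 1` for every `x` — its order divides `q + 1`. -/
theorem unit_pow_eq_one_of_frobenius (ω : LocalChar R) (σ : R → R) (q : ℕ) (hσ : ∀ x, σ x = x ^ q)
    (h : ConjDualUnit ω σ) (x : R) (hx : IsUnit x) : ω.unit x ^ (q + 1) = 1 := by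
  have hx' := h x
  rw [hσ, map_pow, MulChar.inv_apply_eq_inv'] at hx'
  have hne : ω.unit x ≠ 0 := MulChar.apply_ne_zero_iff.mpr hx
  rw [pow_succ, hx', inv_mul_cancel₀ hne]

end LocalChar

/-! ### The three places of `S₃` of the octic point -/

/-- At `𝔭₁ | 5` (residue degree `f = 1`, `q_K = q_k = 5`): the conjugation is trivial on the residue field `𝔽₅`, so the
tame part of a conjugate-dual character is quadratic or trivial. -/
theorem tame_dual_p1 (ω : LocalChar (ZMod 5)) (σ : ZMod 5 → ZMod 5) (hσ : ∀ x, σ x = x)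
    (h : LocalChar.ConjDualUnit ω σ) : ω.unit * ω.unit = 1 ∧ octic_p1.f = 1 :=
  ⟨LocalChar.unit_mul_self_eq_one_of_fixed ω σ hσ h, rfl⟩

/-- At `𝔭₂ | 5`: the same. -/
theorem tame_dual_p2 (ω : LocalChar (ZMod 5)) (σ : ZMod 5 → ZMod 5) (hσ : ∀ x, σ x = x)
    (h : LocalChar.ConjDualUnit ω σ) : ω.unit * ω.unit = 1 ∧ octic_p2.f = 1 :=
  ⟨LocalChar.unit_mul_self_eq_one_of_fixed ω σ hσ h, rfl⟩

/-- At `𝔮 | 2` (`q_k = 4`, `q_K = 16`, `f = 2`): the conjugation is the Frobenius `x ↦ x ^ 4` of `𝔽₁₆ / 𝔽₄`, so the tame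
part of a conjugate-dual character has order dividing `q_k + 1 = 5`. -/
theorem tame_dual_q {R : Type} [CommRing R] (ω : LocalChar R) (σ : R → R) (hσ : ∀ x, σ x = x ^ octic_q.qk)
    (h : LocalChar.ConjDualUnit ω σ) (x : R) (hx : IsUnit x) : ω.unit x ^ 5 = 1 :=
  LocalChar.unit_pow_eq_one_of_frobenius ω σ octic_q.qk hσ h x hx

/-- The orders `2` and `5` of the tame parts are coprime to the residue characteristics `5` and `2` respectively, and
divide `q_K − 1 = 4`, resp. `15` — consistent with gen 1's `S3Place.tame_coprime`. -/
theorem tame_orders : (2 ∣ octic_p1.qK - 1) ∧ (5 ∣ octic_q.qK - 1) ∧ Nat.Coprime 2 octic_p1.p ∧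
    Nat.Coprime 5 octic_q.p := by decide

end Summit.Ventures.HodgeRepro.PeriodCloser

end
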